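import Literature.Algebra.Homology.EulerPoincarePrinciple
import Mathlib.RingTheory.Length
import HarnessLib

/-!
# The Euler–Poincaré formula for the LENGTH of modules over an arbitrary ring

Layer `Literature/Algebra/Homology` (pure algebra over Mathlib; proved theorems only, 0 definitions, 0 named facts, no instances, no notation).
Lang, *Algebra* XX §3, Thm. 3.1 is printed for an Euler–Poincaré map on modules over a ring — the model case being the LENGTH
(multiplicities, Serre's intersection numbers are alternating sums of lengths): for a homological complex `C` of `R`-modules of finite length
(Mathlib `Module.length : ℕ∞`, `IsFiniteLength`), of ANY shape `c` with `EulerCharSigns` and finitely many non-zero terms,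
`Σ (−1)ⁱ ℓ(Cᵢ) = Σ (−1)ⁱ ℓ(Hᵢ(C))`. Over a division ring `ℓ = finrank` (Mathlib `Module.length_eq_finrank`) and this is row
`EulerPoincareFormula` (said, not restated).

* `length_X₂_eq` — for a short complex `S : X₁ → X₂ → X₃` of `R`-modules, `ℓ(X₂) = ℓ(H(S)) + ℓ(range g) + ℓ(range f)` in `ℕ∞`, with NO
  finiteness hypothesis (Mathlib `Module.length_eq_add_of_exact` twice, `LinearEquiv.length_eq` on `X₂ ⁄ ker g ≅ range g`, Mathlib's
  `moduleCatHomologyIso : H(S) ≅ ker g ⁄ range(X₁ → ker g)` and `range(X₁ → ker g) ≅ range f`);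
* `length_X_eq` — degreewise on a complex: `ℓ(Cᵢ) = ℓ(Hᵢ) + ℓ(im d(i, next i)) + ℓ(im d(prev i, i))`;
* **`finsum_χ_smul_length_eq : Σᶠ χ(i) • ℓ(Cᵢ) = Σᶠ χ(i) • ℓ(Hᵢ(C))`** in `ℤ` (`ℓ = (Module.length R _).toNat`, finite-length terms, finitely
  many non-zero) — row `EulerPoincarePrinciple`'s additive principle `finsum_χ_smul_eq_of_degreewise`, BY NAME;
* `CochainComplex.sum_negOnePow_smul_length_eq` (the `ℤ`-`Icc` form) and `finsum_χ_smul_length_eq_zero_of_exactAt` (acyclic complexes).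

Library only (cell `pub-hodge-ring2`, count-neutral); proves nothing about any crux, route or conjecture.

## References

* S. Lang, *Algebra* (2002), Ch. XX §3, Thm. 3.1 (Euler–Poincaré maps; the Euler characteristic `χ_φ`). [Lang2002]
* N. Bourbaki, *Algèbre, Chapitre VIII* (2012), §20 n°6 (additive functions of modules along exact sequences). [BourbakiAlgebreVIII2012]
-/

open CategoryTheory CategoryTheory.Limits

universe v u w

namespace Literature.Algebra.Homology.HopfTrace

variable {R : Type u} [Ring R]

/-! ### One short complex -/

/-- **`ℓ(X₂) = ℓ(H(S)) + ℓ(range g) + ℓ(range f)`** in `ℕ∞` for a short complex of `R`-modules (no finiteness needed).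
[cite: Lang2002, Ch. XX §3, Thm. 3.1] [cite: BourbakiAlgebreVIII2012, VIII §20 n°6] -/
theorem length_X₂_eq (S : ShortComplex (ModuleCat.{v} R)) :
    Module.length R S.X₂ =
      Module.length R S.homology + Module.length R (LinearMap.range S.g.hom) + Module.length R (LinearMap.range S.f.hom) := by
  -- `X₂` along `ker g`
  have h1 : Module.length R S.X₂ = Module.length R (LinearMap.ker S.g.hom) + Module.length R (LinearMap.range S.g.hom) := by
    rw [Module.length_eq_add_of_exact (LinearMap.ker S.g.hom).subtype (LinearMap.ker S.g.hom).mkQ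
      (LinearMap.ker S.g.hom).injective_subtype (Submodule.mkQ_surjective _) (LinearMap.exact_subtype_mkQ _),
      S.g.hom.quotKerEquivRange.length_eq]
  -- `ker g` along `range(X₁ → ker g)`
  have h2 : Module.length R (LinearMap.ker S.g.hom) =
      Module.length R (LinearMap.range S.f.hom) + Module.length R S.homology := by
    rw [Module.length_eq_add_of_exact (LinearMap.range S.moduleCatToCycles).subtype (LinearMap.range S.moduleCatToCycles).mkQ
      (LinearMap.range S.moduleCatToCycles).injective_subtype (Submodule.mkQ_surjective _) (LinearMap.exact_subtype_mkQ _)]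
    have e₁ : LinearMap.range S.moduleCatToCycles ≃ₗ[R] LinearMap.range S.f.hom :=
      (Submodule.equivMapOfInjective _ (LinearMap.ker S.g.hom).injective_subtype _).trans
        (LinearEquiv.ofEq _ _ (by rw [← LinearMap.range_comp]; rfl))
    have e₂ : S.homology ≃ₗ[R] (LinearMap.ker S.g.hom ⧸ LinearMap.range S.moduleCatToCycles) := S.moduleCatHomologyIso.toLinearEquiv
    rw [e₁.length_eq, e₂.length_eq]
  rw [h1, h2]
  ring

variable {ι : Type w} {c : ComplexShape ι} (C : HomologicalComplex (ModuleCat.{v} R) c)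

/-! ### A complex -/

/-- **Degreewise**: `ℓ(Cᵢ) = ℓ(Hᵢ(C)) + ℓ(im d(i, next i)) + ℓ(im d(prev i, i))` in `ℕ∞` (`length_X₂_eq` on `C.sc i`).
[cite: Lang2002, Ch. XX §3, Thm. 3.1] -/
theorem length_X_eq (i : ι) :
    Module.length R (C.X i) = Module.length R (C.homology i) +
      Module.length R (LinearMap.range (C.d i (c.next i)).hom) + Module.length R (LinearMap.range (C.d (c.prev i) i).hom) :=
  length_X₂_eq (C.sc i)

/-- The image `im d(i, j)` has length `0` when `i`, `j` are not related. [cite: Lang2002, Ch. XX §3] -/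
theorem length_range_d_eq_zero (i j : ι) (h : ¬c.Rel i j) : Module.length R (LinearMap.range (C.d i j).hom) = 0 := by
  rw [C.shape _ _ h, ModuleCat.hom_zero, LinearMap.range_zero, Module.length_bot]

/-- **The Euler–Poincaré formula for the length** (Lang XX §3, Thm. 3.1): for a homological complex of `R`-modules of finite length,
of any shape with `EulerCharSigns` and finitely many non-zero terms, `Σᶠ χ(i) • ℓ(Cᵢ) = Σᶠ χ(i) • ℓ(Hᵢ(C))` in `ℤ`, where
`ℓ = (Module.length R _).toNat`. [cite: Lang2002, Ch. XX §3, Thm. 3.1] -/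
theorem finsum_χ_smul_length_eq [c.EulerCharSigns] (hfin : ∀ i, IsFiniteLength R (C.X i))
    (hC : (Function.support fun i => Module.length R (C.X i)).Finite) :
    ∑ᶠ i, (c.χ i : ℤ) • ((Module.length R (C.X i)).toNat : ℤ) =
      ∑ᶠ i, (c.χ i : ℤ) • ((Module.length R (C.homology i)).toNat : ℤ) := by
  have htop : ∀ i, Module.length R (C.X i) ≠ ⊤ := fun i => Module.length_ne_top_iff.2 (hfin i)
  -- the three summands of `length_X_eq` are finite, and `0` where `Cᵢ = 0`
  have hne : ∀ i, Module.length R (C.homology i) ≠ ⊤ ∧ Module.length R (LinearMap.range (C.d i (c.next i)).hom) ≠ ⊤ ∧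
      Module.length R (LinearMap.range (C.d (c.prev i) i).hom) ≠ ⊤ := fun i => by
    have h := htop i
    rw [length_X_eq C i] at h
    simp only [ne_eq, ENat.add_eq_top, not_or] at h
    exact ⟨h.1.1, h.1.2, h.2⟩
  have hzero : ∀ i, Module.length R (C.X i) = 0 → Module.length R (C.homology i) = 0 ∧
      Module.length R (LinearMap.range (C.d i (c.next i)).hom) = 0 ∧ Module.length R (LinearMap.range (C.d (c.prev i) i).hom) = 0 :=
    fun i h0 => by
    have h := length_X_eq C i
    rw [h0, eq_comm, add_eq_zero, add_eq_zero] at h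
    exact ⟨h.1.1, h.1.2, h.2⟩
  -- supports
  have hsupp : ∀ (g : ι → ℕ∞), (∀ i, Module.length R (C.X i) = 0 → g i = 0) → (fun i => ((g i).toNat : ℤ)).HasFiniteSupport :=
    fun g hg => hC.subset fun i hi => by
      simp only [Function.mem_support, ne_eq] at hi ⊢
      exact fun h0 => hi (by rw [hg i h0, ENat.toNat_zero, Nat.cast_zero])
  have hA : ∀ i, Module.length R (C.X i) = 0 → Module.length R (LinearMap.range (C.d i (c.next i)).hom) = 0 := fun i h0 => (hzero i h0).2.1
  -- the additive Euler–Poincaré principle in `ℤ`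
  refine finsum_χ_smul_eq_of_degreewise (c := c) _ _
    (fun i => ((Module.length R (LinearMap.range (C.d i (c.next i)).hom)).toNat : ℤ))
    (fun j => ((Module.length R (LinearMap.range (C.d (c.prev j) j).hom)).toNat : ℤ)) (fun i => ?_)
    (fun j hj => by rw [length_range_d_eq_zero C _ _ hj, ENat.toNat_zero, Nat.cast_zero])
    (fun i hi => by rw [length_range_d_eq_zero C _ _ hi, ENat.toNat_zero, Nat.cast_zero])
    (fun i j hij => by
      have h1 : c.prev j = i := c.prev_eq' hij
      have h2 : c.next i = j := c.next_eq' hij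
      subst h1
      rw [h2])
    (hsupp _ fun i h0 => (hzero i h0).1) (hsupp _ hA) (hsupp _ fun i h0 => (hzero i h0).2.2)
  -- degreewise: `length_X_eq` read in `ℕ`
  have h12 : Module.length R (C.homology i) + Module.length R (LinearMap.range (C.d i (c.next i)).hom) ≠ ⊤ := by
    simp only [ne_eq, ENat.add_eq_top, not_or]
    exact ⟨(hne i).1, (hne i).2.1⟩
  have h := congrArg ENat.toNat (length_X_eq C i)
  rw [ENat.toNat_add h12 (hne i).2.2, ENat.toNat_add (hne i).1 (hne i).2.1] at h
  rw [h]
  push_cast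
  ring

/-- **Acyclic complexes**: `Σᶠ χ(i) • ℓ(Cᵢ) = 0` for an exact complex of finite-length modules with finitely many non-zero terms.
[cite: Lang2002, Ch. XX §3, Thm. 3.1] -/
theorem finsum_χ_smul_length_eq_zero_of_exactAt [c.EulerCharSigns] (hfin : ∀ i, IsFiniteLength R (C.X i))
    (hC : (Function.support fun i => Module.length R (C.X i)).Finite) (hex : ∀ i, C.ExactAt i) :
    ∑ᶠ i, (c.χ i : ℤ) • ((Module.length R (C.X i)).toNat : ℤ) = 0 := by
  rw [finsum_χ_smul_length_eq C hfin hC]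
  exact finsum_eq_zero_of_forall_eq_zero fun i => by
    haveI : Subsingleton (C.homology i) := ModuleCat.subsingleton_of_isZero ((C.exactAt_iff_isZero_homology i).1 (hex i))
    rw [Module.length_eq_zero, ENat.toNat_zero, Nat.cast_zero, smul_zero]

end Literature.Algebra.Homology.HopfTrace

/-- **`ℤ`-indexed cochain form**: for a cochain complex of finite-length `R`-modules vanishing outside `[a, b]`,
`Σ_{n=a}^{b} (−1)ⁿ ℓ(Cⁿ) = Σ_{n=a}^{b} (−1)ⁿ ℓ(Hⁿ(C))`. [cite: Lang2002, Ch. XX §3, Thm. 3.1] -/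
theorem Literature.Algebra.Homology.CochainComplex.sum_negOnePow_smul_length_eq {R : Type u} [Ring R]
    (C : CochainComplex (ModuleCat.{v} R) ℤ) (hfin : ∀ n, IsFiniteLength R (C.X n)) (a b : ℤ)
    (hC : ∀ n, n ∉ Finset.Icc a b → IsZero (C.X n)) :
    ∑ n ∈ Finset.Icc a b, (n.negOnePow : ℤ) • ((Module.length R (C.X n)).toNat : ℤ) =
      ∑ n ∈ Finset.Icc a b, (n.negOnePow : ℤ) • ((Module.length R (C.homology n)).toNat : ℤ) := by
  have h0 : ∀ n, n ∉ Finset.Icc a b → Module.length R (C.X n) = 0 := fun n hn => by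
    haveI := ModuleCat.subsingleton_of_isZero (hC n hn)
    exact Module.length_eq_zero
  have hsupp : (Function.support fun n => Module.length R (C.X n)) ⊆ (Finset.Icc a b : Set ℤ) := fun n hn => by
    by_contra hn'
    exact hn (h0 n hn')
  have h := Literature.Algebra.Homology.HopfTrace.finsum_χ_smul_length_eq C hfin ((Finset.Icc a b).finite_toSet.subset hsupp)
  rw [finsum_eq_sum_of_support_subset _ (s := Finset.Icc a b), finsum_eq_sum_of_support_subset _ (s := Finset.Icc a b)] at h
  · simpa using h
  · intro n hn
    by_contra hn'
    have hH : Module.length R (C.homology n) = 0 := by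
      have h' := Literature.Algebra.Homology.HopfTrace.length_X_eq C n
      rw [h0 n hn', eq_comm, add_eq_zero, add_eq_zero] at h'
      exact h'.1.1
    exact hn (by simp only [hH, ENat.toNat_zero, Nat.cast_zero, smul_zero])
  · intro n hn
    by_contra hn'
    exact hn (by simp only [h0 n hn', ENat.toNat_zero, Nat.cast_zero, smul_zero])
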